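import Literature.Probability.LatticeModels.PlaneRotatorTorusBoxCriterion
import Literature.Probability.LatticeModels.LayeredPlaneRotatorSusceptibility
import Literature.Probability.LatticeModels.AnisotropicPlaneRotatorLRO
import HarnessLib

/-!
# Lieb's rectangular-box criterion on the torus for DIRECTION-DEPENDENT couplings, and the layered XY model on
# `(ℤ/Lℤ)³`: a ceiling on the SAME object (`AnisotropicRotator.corr`, `plateau`) as the infrared-bound floor

Topic `Literature/Probability/LatticeModels`. E. H. Lieb, Comm. Math. Phys. **77** (1980) 127, eq. (23), Theorem 4
and p. 128 (boxes: the finite algorithm); B. Simon, ibid. 111, Thm 1.3 [Lieb1980] [Simon1980CMP] [Rivasseau1980];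
the layered couplings `(J, J, εJ)` of L. L. Liu, H. E. Stanley, Phys. Rev. Lett. **29** (1972) 927 / Phys. Rev. B **8**
(1973) 2279 [LiuStanley1972].

The tree holds Lieb's criterion with ANISOTROPIC reference boxes `∏_i [−R_i, R_i]` for every finite `Λ ⊂ ℤ^ν` with
free boundary conditions (`PlaneRotator.twoPoint_le_pow_aboxShellSum`, Lieb's number `aboxShellSum Jf Rv`; the slab
`Rv = (R, R, 1)` for the layered model: `slabShellSum β J∥ J⊥ R`, `twoPoint_layered_le_pow_slabShellSum`, and its
reduction to two numbers of ONE two-dimensional box `S^{slab}_R ≤ S_R(βJ∥) + βJ⊥·χ^{int}_R(βJ∥)`,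
`slabShellSum_le_box2D`), and the cubic-box criterion on the torus for a UNIFORM coupling
(`torusXY_expectJ_cosDiff_le_pow_nnBoxShellSum`, `PlaneRotatorTorusBoxCriterion.lean`). This file is the periodic
instance with direction-dependent couplings `K = (K_i)` and radii `Rv = (R_i)`:

* §1 the fibre-summed pair coupling of `torusXY d L` at couplings `K_i` per direction (`K_i` on the ordered pair
  `(x, x + eᵢ)`), its symmetrisation (`K_i/2` on torus-adjacent pairs) and support;
* §2 per-coordinate box coordinates `coord_x(y)_i = valMinAbs (y − x)_i ∈ ℤ` (written inline): the cyclic triangle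
  inequality per coordinate, no wrap-around in direction `i` inside `|coord_i| ≤ R_i` for `L ≥ 2R_i + 2`, the index
  `aIndex Rv (coord)` drops by at most one across a box;
* §3 **the criterion** `torusXY_expectJ_cosDiff_le_pow_aboxShellSum`: for `K_i ≥ 0`, `R_i ≥ 1`, `L ≥ 2R_i + 2`, and any
  reference coupling `Jf ≥ 0` on `ℤ^d` dominating `K_i/2` on the nearest-neighbour bonds of direction `i`,
  `⟨cos(θ_a − θ_c)⟩_{K,L} ≤ S_{Rv}(Jf)^{aIndex Rv (coord_c(a))}` — the SAME number `S_{Rv}(Jf) = aboxShellSum Jf Rv`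
  as for the free boxes;
* §4 the bridge `AnisotropicRotator.corr K x y = ⟨cos(θ_x − θ_y)⟩_{K,L}` (angle cube ↔ `U(1)^{𝕋_L}` ↔ `BondSystem.expectJ`
  of `torusXY 3 L`), so that the criterion speaks about the object of the Fröhlich–Israel–Lieb–Simon /
  Kennedy–Lieb–Shastry FLOOR files (`AnisotropicPlaneRotatorInfraredFloor.lean`, `AnisotropicLatticeGreenLimit.lean`,
  `AnisotropicInfraredConstantLog.lean`: `plateau L (layeredCoupling K∥ K⊥) ≥ 1 − C(K⊥/K∥)/K∥ − ε`);
* §5 **the layered torus**: `corr (layeredCoupling (βJ∥) (βJ⊥)) x y ≤ S^{slab}_R(β; J∥, J⊥)^{max(⌊d₀/R⌋, ⌊d₁/R⌋, d₂)}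
  ≤ (S_R(βJ∥) + βJ⊥·χ^{int}_R(βJ∥))^{…}` (`d_i` the cyclic coordinate distances), the across-layers form, and
* §6 **no long-range order on the torus in Lieb's phase**: if one slab number is `≤ m < 1` then the torus
  susceptibility `∑_y ⟨cos(θ_x − θ_y)⟩_L` is bounded by the lattice sum `∑_{z ∈ ℤ³} m^{⌊‖z‖_∞/R⌋}` uniformly in
  `L ≥ 2R + 2` and `plateau_L ≤ C/L³`; explicit windows (`T ≥ 2J∥ ∧ J⊥ ≤ 0.0298·T`, the near-star pair) and the
  qualitative weak-coupling statement (`S_R(K∥) < 1` for one `R` — every `K∥ < log(1+√2)` by the tree's Onsager window —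
  and `K⊥ ≤ (1 − S_R)/(2(χ^{int}_R + 1))` ⇒ `plateau_L → 0`).

In words (classical layered XY comparison model of the `hubbard-tc` cell, MO-S3 2D→3D grammar): on the periodic
lattice, where reflection positivity gives the ordering FLOOR `plateau_L ≥ 1 − (1 + ln(J∥/J⊥)/(2π))/(βJ∥) − ε`, Lieb's
finite algorithm gives the CEILING `plateau_L → 0` throughout the weak-interlayer windows — floor and ceiling on one
order parameter; and `limsup_{J⊥→0}` of any torus-LRO temperature is at most the two-dimensional box-criterion
temperature, itself `≤ J∥/log(1+√2)`.

## What this is not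

A classical comparison-model statement (no electrons); no number is asserted about `S_R` beyond the tree's
`S_1 = 4u(K)` and the Amos bound; `plateau_L → 0` is absence of long-range order at these couplings, not a value of a
transition temperature; the Kosterlitz–Thouless window between the explicit ceilings and the floor is untouched.
-/

noncomputable section

open MeasureTheory Finset Filter
open scoped BigOperators Topology

namespace Literature.Probability.LatticeModels

open PlaneRotator Literature.Barriers.CriticalPhenomena Literature.Barriers.CriticalPhenomena.LongRangeIsing
open Literature.MathematicalPhysics.QuantumLattice

variable {d L : ℕ} [NeZero L]

/-! ## §1 Direction-dependent pair couplings of `torusXY d L` -/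

section Coupling

/-- **The fibre-summed pair coupling of `torusXY d L` at couplings `K_i` per direction**:
`J(x, y) = ∑_i K_i·[x + eᵢ = y]`. [cite: Lieb1980, Theorem 4 (nearest-neighbour rotators on a hypercubic lattice)] -/
theorem torusXY_pairCoupling_apply_fun (K : Fin d → ℝ) (x y : TorusSite d L) :
    (torusXY d L).pairCoupling (fun b => K b.2) (x, y) =
      ∑ i : Fin d, if x + Pi.single i 1 = y then K i else 0 := by
  unfold BondSystem.pairCoupling
  rw [Finset.sum_filter, Fintype.sum_prod_type]
  have hst : ∀ (z : TorusSite d L) (i : Fin d), ((torusXY d L).src (z, i), (torusXY d L).tgt (z, i)) =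
      (z, z + Pi.single i 1) := fun z i => rfl
  simp only [hst, Prod.mk.injEq]
  rw [Finset.sum_comm]
  refine Finset.sum_congr rfl fun i _ => ?_
  rw [show (∑ z : TorusSite d L, if z = x ∧ z + Pi.single i 1 = y then K i else 0) =
      ∑ z : TorusSite d L, if z = x then (if x + Pi.single i 1 = y then K i else 0) else 0 from
    Finset.sum_congr rfl fun z _ => by
      by_cases hz : z = x
      · subst hz; simp
      · simp [hz]]
  rw [Finset.sum_ite_eq' Finset.univ x, if_pos (Finset.mem_univ x)]

omit [NeZero L] in
/-- `∑_i K_i [x + eᵢ = y] ≥ 0` for `K ≥ 0`. [cite: Lieb1980, Theorem 4 — plumbing] -/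
theorem torusXY_dirSum_nonneg {K : Fin d → ℝ} (hK : ∀ i, 0 ≤ K i) (x y : TorusSite d L) :
    0 ≤ ∑ i : Fin d, if x + Pi.single i 1 = y then K i else 0 :=
  Finset.sum_nonneg fun i _ => by split_ifs <;> [exact hK i; exact le_rfl]

omit [NeZero L] in
/-- On the bond `(y, y + eᵢ)` the directional sum is `K_i` (`L ≥ 2`: the unit vectors are distinct).
[cite: Lieb1980, Theorem 4 — plumbing] -/
theorem torusXY_dirSum_add_single (hL : 2 ≤ L) (K : Fin d → ℝ) (y : TorusSite d L) (i : Fin d) :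
    (∑ j : Fin d, if y + Pi.single j 1 = y + Pi.single i 1 then K j else 0) = K i := by
  classical
  rw [Finset.sum_eq_single i (fun j _ hj => ?_) (fun hi => absurd (Finset.mem_univ i) hi), if_pos rfl]
  rw [if_neg]
  intro hj'
  exact hj (torus_single_injective hL (add_left_cancel hj'))

omit [NeZero L] in
/-- On the reversed bond `(y + eᵢ, y)` the directional sum vanishes (`L ≥ 3`: `eᵢ + eⱼ ≠ 0`).
[cite: Lieb1980, Theorem 4 — plumbing] -/
theorem torusXY_dirSum_add_single_rev (hL : 3 ≤ L) (K : Fin d → ℝ) (y : TorusSite d L) (i : Fin d) :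
    (∑ j : Fin d, if y + Pi.single i 1 + Pi.single j 1 = y then K j else 0) = 0 := by
  refine Finset.sum_eq_zero fun j _ => if_neg fun h => ?_
  refine torus_single_add_single_ne_zero hL i j ?_
  rw [add_assoc] at h
  exact add_left_cancel (h.trans (add_zero y).symm)

/-- **The symmetrised coupling**: `(J(x,y) + J(y,x))/2 = (∑_i K_i[x + eᵢ = y] + ∑_i K_i[y + eᵢ = x])/2`.
[cite: Lieb1980, Theorem 4 (nearest-neighbour rotators)] -/
theorem torusXY_symmCoupling_pairCoupling_fun (K : Fin d → ℝ) (x y : TorusSite d L) :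
    symmCoupling ((torusXY d L).pairCoupling fun b => K b.2) (x, y) =
      ((∑ i : Fin d, if x + Pi.single i 1 = y then K i else 0) +
        ∑ i : Fin d, if y + Pi.single i 1 = x then K i else 0) / 2 := by
  rw [symmCoupling]
  dsimp only [Prod.swap_prod_mk]
  rw [torusXY_pairCoupling_apply_fun, torusXY_pairCoupling_apply_fun]

/-- The symmetrised coupling is non-negative for `K ≥ 0`. [cite: Lieb1980, Theorem 4 — plumbing] -/
theorem torusXY_symmCoupling_fun_nonneg {K : Fin d → ℝ} (hK : ∀ i, 0 ≤ K i) (p : TorusSite d L × TorusSite d L) :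
    0 ≤ symmCoupling ((torusXY d L).pairCoupling fun b => K b.2) p :=
  symmCoupling_nonneg ((torusXY d L).pairCoupling_nonneg fun b => hK b.2) p

/-- **Value on a bond**: for `L ≥ 3` the symmetrised coupling of `(y, y + eᵢ)` and of `(y + eᵢ, y)` is `K_i/2`.
[cite: Lieb1980, Theorem 4 (nearest-neighbour rotators)] -/
theorem torusXY_symmCoupling_add_single (hL : 3 ≤ L) (K : Fin d → ℝ) (y : TorusSite d L) (i : Fin d) :
    symmCoupling ((torusXY d L).pairCoupling fun b => K b.2) (y, y + Pi.single i 1) = K i / 2 ∧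
      symmCoupling ((torusXY d L).pairCoupling fun b => K b.2) (y + Pi.single i 1, y) = K i / 2 := by
  rw [torusXY_symmCoupling_pairCoupling_fun, torusXY_symmCoupling_pairCoupling_fun,
    torusXY_dirSum_add_single (by omega) K y i, torusXY_dirSum_add_single_rev hL K y i]
  exact ⟨by ring, by ring⟩

/-- **Support**: a non-zero symmetrised coupling joins a bond, `y = x + eᵢ` or `x = y + eᵢ` for some `i`.
[cite: Lieb1980, Theorem 4 (nearest-neighbour range)] -/
theorem torusXY_exists_single_of_symmCoupling_ne_zero {K : Fin d → ℝ} {x y : TorusSite d L}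
    (h : symmCoupling ((torusXY d L).pairCoupling fun b => K b.2) (x, y) ≠ 0) :
    ∃ i : Fin d, x + Pi.single i 1 = y ∨ y + Pi.single i 1 = x := by
  rw [torusXY_symmCoupling_pairCoupling_fun] at h
  have hsum : (∑ i : Fin d, if x + Pi.single i 1 = y then K i else 0) +
      (∑ i : Fin d, if y + Pi.single i 1 = x then K i else 0) ≠ 0 := fun h0 => h (by rw [h0, zero_div])
  by_cases hx : (∑ i : Fin d, if x + Pi.single i 1 = y then K i else 0) = 0
  · rw [hx, zero_add] at hsum
    obtain ⟨i, -, hi⟩ := Finset.exists_ne_zero_of_sum_ne_zero hsum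
    exact ⟨i, Or.inr (by by_contra hc; exact hi (if_neg hc))⟩
  · obtain ⟨i, -, hi⟩ := Finset.exists_ne_zero_of_sum_ne_zero hx
    exact ⟨i, Or.inl (by by_contra hc; exact hi (if_neg hc))⟩

end Coupling

/-! ## §2 Per-coordinate box coordinates on the torus -/

section Coord

omit [NeZero L] in
/-- The cyclic triangle inequality per coordinate: `|coord_x(z)_j| ≤ |coord_x(y)_j| + |valMinAbs (z − y)_j|`.
[cite: FriedliVelenik2017, §3.1 (periodic distance) — plumbing] -/
theorem natAbs_valMinAbs_coord_le (x y z : TorusSite d L) (j : Fin d) :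
    ((z - x) j).valMinAbs.natAbs ≤ ((y - x) j).valMinAbs.natAbs + ((z - y) j).valMinAbs.natAbs := by
  have h : (z - x) j = (y - x) j + (z - y) j := by simp only [Pi.sub_apply]; ring
  rw [h]
  exact (ZMod.natAbs_valMinAbs_add_le _ _).trans (Int.natAbs_add_le _ _)

omit [NeZero L] in
/-- A unit vector has cyclic coordinates `≤ 1`: `|valMinAbs (eᵢ)_j| ≤ 1`. [cite: FriedliVelenik2017, §3.1 — plumbing] -/
theorem natAbs_valMinAbs_single_le (hL : 2 ≤ L) (i j : Fin d) :
    ((Pi.single i (1 : ZMod L) : TorusSite d L) j).valMinAbs.natAbs ≤ 1 := by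
  haveI : NeZero L := ⟨by omega⟩
  rcases eq_or_ne j i with rfl | hj
  · rw [Pi.single_eq_same, ZMod.valMinAbs_natAbs_eq_min]
    exact cyclicAbs_one_le
  · rw [Pi.single_eq_of_ne hj, ZMod.valMinAbs_zero]; simp

omit [NeZero L] in
/-- **Adjacent sites have adjacent coordinates**: `|coord_x(y + eᵢ)_j| ≤ |coord_x(y)_j| + 1` and
`|coord_x(y)_j| ≤ |coord_x(y + eᵢ)_j| + 1` for every `j`. [cite: FriedliVelenik2017, §3.1 — plumbing] -/
theorem natAbs_valMinAbs_coord_add_single_le (hL : 2 ≤ L) (x y : TorusSite d L) (i j : Fin d) :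
    ((y + Pi.single i 1 - x : TorusSite d L) j).valMinAbs.natAbs ≤ ((y - x) j).valMinAbs.natAbs + 1 ∧
      ((y - x) j).valMinAbs.natAbs ≤ ((y + Pi.single i 1 - x : TorusSite d L) j).valMinAbs.natAbs + 1 := by
  constructor
  · refine (natAbs_valMinAbs_coord_le x y (y + Pi.single i 1) j).trans (Nat.add_le_add_left ?_ _)
    rw [add_sub_cancel_left]
    exact natAbs_valMinAbs_single_le hL i j
  · refine (natAbs_valMinAbs_coord_le x (y + Pi.single i 1) y j).trans (Nat.add_le_add_left ?_ _)
    rw [show y - (y + Pi.single i 1) = -(Pi.single i 1 : TorusSite d L) by abel, Pi.neg_apply,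
      ZMod.natAbs_valMinAbs_neg]
    exact natAbs_valMinAbs_single_le hL i j

omit [NeZero L] in
/-- The coordinates are even: `|coord_c(x)_i| = |coord_x(c)_i|`. [cite: FriedliVelenik2017, §3.1 — plumbing] -/
theorem natAbs_valMinAbs_coord_comm (x c : TorusSite d L) (i : Fin d) :
    ((x - c) i).valMinAbs.natAbs = ((c - x) i).valMinAbs.natAbs := by
  rw [show x - c = -(c - x) by abel, Pi.neg_apply, ZMod.natAbs_valMinAbs_neg]

omit [NeZero L] in
/-- **No wrap-around in direction `i` inside `|coord_i| ≤ R_i` for `L ≥ 2R_i + 2`**: if `|coord_x(y)_j| ≤ R_j` and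
`|coord_x(y + eᵢ)_j| ≤ R_j` for `j = i`, then `coord_x(y + eᵢ) = coord_x(y) + eᵢ` in `ℤ^d`.
[cite: Lieb1980, p. 128 (the box as inside system) — transport to the torus] -/
theorem torusBoxCoord_add_single_of_le {Rv : Fin d → ℕ} {i : Fin d} (hL : 2 * Rv i + 2 ≤ L) {x y : TorusSite d L}
    (hy : ((y - x) i).valMinAbs.natAbs ≤ Rv i) (hy' : ((y + Pi.single i 1 - x : TorusSite d L) i).valMinAbs.natAbs ≤ Rv i) :
    (fun j => ((y + Pi.single i 1 - x : TorusSite d L) j).valMinAbs : Site d) =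
      (fun j => ((y - x) j).valMinAbs : Site d) + Pi.single i (1 : ℤ) := by
  funext j
  rcases eq_or_ne j i with rfl | hj
  · have e : ((y + Pi.single j 1 - x : TorusSite d L) j) = (y - x) j + 1 := by
      simp only [Pi.sub_apply, Pi.add_apply, Pi.single_eq_same]; ring
    rw [e] at hy'
    show ((y + Pi.single j 1 - x : TorusSite d L) j).valMinAbs = ((y - x) j).valMinAbs + (Pi.single j (1 : ℤ) : Site d) j
    rw [Pi.single_eq_same, e]
    exact valMinAbs_add_one_of_le hL hy hy'
  · simp only [Pi.add_apply, Pi.sub_apply, Pi.single_eq_of_ne hj, add_zero]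

/-- **The index drops by at most one across a box** (per-coordinate form): if `|u_i| ≤ |v_i| + R_i` for all `i` then
`aIndex Rv u ≤ aIndex Rv v + 1`. [cite: Simon1980CMP, Thm 1.3] -/
theorem aIndex_le_succ_of_forall_le {ν : ℕ} {Rv : Fin ν → ℕ} (hR : ∀ i, 1 ≤ Rv i) {u v : Site ν}
    (h : ∀ i, (u i).natAbs ≤ (v i).natAbs + Rv i) : aIndex Rv u ≤ aIndex Rv v + 1 := by
  unfold aIndex
  refine Finset.sup_le fun i _ => ?_
  calc (u i).natAbs / Rv i ≤ ((v i).natAbs + Rv i) / Rv i := Nat.div_le_div_right (h i)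
    _ = (v i).natAbs / Rv i + 1 := Nat.add_div_right _ (hR i)
    _ ≤ (Finset.univ.sup fun j => (v j).natAbs / Rv j) + 1 :=
        Nat.add_le_add_right (Finset.le_sup (f := fun j => (v j).natAbs / Rv j) (Finset.mem_univ i)) 1

/-- The index only sees absolute values of the coordinates. [cite: Simon1980CMP, Thm 1.3 — plumbing] -/
theorem aIndex_congr_natAbs {ν : ℕ} (Rv : Fin ν → ℕ) {u v : Site ν} (h : ∀ i, (u i).natAbs = (v i).natAbs) :
    aIndex Rv u = aIndex Rv v := by
  unfold aIndex
  exact Finset.sup_congr rfl fun i _ => by rw [h i]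

end Coord

/-! ## §3 The rectangular-box criterion on the torus with direction-dependent couplings -/

section Criterion

variable [MeasurableSpace Circle] [BorelSpace Circle]

/-- **Lieb's box criterion on the torus `(ℤ/Lℤ)^d`, direction-dependent couplings and radii.** Let `K_i ≥ 0`,
`R_i ≥ 1`, `L ≥ 2R_i + 2` for all `i`, and let `Jf ≥ 0` be a pair coupling on `ℤ^d` dominating the torus couplings
on nearest-neighbour bonds: `K_i/2 ≤ Jf(u, u + eᵢ)` and `K_i/2 ≤ Jf(u + eᵢ, u)` for all `u, i`. Then for all `a, c`:

  `⟨cos(θ_a − θ_c)⟩_{K,L} ≤ S_{Rv}(Jf)^{aIndex Rv (coord_c a)}`,  `S_{Rv}(Jf) = aboxShellSum Jf Rv`,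

`coord_c(a)_i = valMinAbs (a − c)_i` — Lieb's number of the FREE reference box `∏[−R_i, R_i]` (shell–shell bonds
removed). Proof: (23) with the torus box `A_x = {|coord_x(·)_i| ≤ R_i ∀ i}` and its shell (coordinates not all in the
open box) as inside system — nearest-neighbour range and the per-coordinate cyclic triangle inequality put the start of
every leaving bond on the shell; in box coordinates the inside system embeds into the reference system (no wrap-around
for `L ≥ 2R_i + 2`; Griffiths–Ginibre `twoPoint_le_of_injOn`), so every shell row sum is `≤ S_{Rv}(Jf)`; Simon's
iteration with `d = aIndex Rv ∘ coord_c` (`twoPoint_le_pow_of_shell_rowSum_le`). Hence `S_{Rv} < 1` for ONE radius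
vector certifies exponential decay of the torus two-point function uniformly in `L`.
[cite: Lieb1980, eq. (23), Theorem 4 and p. 128 (boxes; finite algorithm); Simon1980CMP, Thm 1.3] -/
theorem torusXY_expectJ_cosDiff_le_pow_aboxShellSum {K : Fin d → ℝ} (hK : ∀ i, 0 ≤ K i) {Rv : Fin d → ℕ}
    (hR : ∀ i, 1 ≤ Rv i) (hL : ∀ i, 2 * Rv i + 2 ≤ L) {Jf : Site d → Site d → ℝ} (hJf0 : ∀ u v, 0 ≤ Jf u v)
    (hdom : ∀ (u : Site d) (i : Fin d),
      K i / 2 ≤ Jf u (u + Pi.single i 1) ∧ K i / 2 ≤ Jf (u + Pi.single i 1) u)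
    (a c : TorusSite d L) :
    (torusXY d L).expectJ (fun b => K b.2) (cosDiff a c) ≤
      aboxShellSum Jf Rv ^ aIndex Rv (fun i => ((a - c) i).valMinAbs) := by
  classical
  -- `d ≥ 1` is not needed: for `d = 0` every index is `0` and the claim is `⟨cos 0⟩ ≤ 1`-shaped; but we need `L ≥ 3`
  -- from some direction only when a bond exists, so we extract it lazily.
  have hL3 : ∀ i : Fin d, 3 ≤ L := fun i => by have := hL i; have := hR i; omega
  -- the symmetrised pair coupling
  set J : TorusSite d L × TorusSite d L → ℝ := symmCoupling ((torusXY d L).pairCoupling fun b => K b.2) with hJdef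
  have hJ0 : ∀ p, 0 ≤ J p := torusXY_symmCoupling_fun_nonneg hK
  rw [(torusXY d L).expectJ_cosDiff_eq_twoPoint, ← twoPoint_symmCoupling]
  -- boxes and shells on the torus, in coordinates around `x`
  set A : TorusSite d L → Finset (TorusSite d L) := fun x =>
    Finset.univ.filter fun y => ∀ i, ((y - x) i).valMinAbs.natAbs ≤ Rv i with hAdef
  set S : TorusSite d L → Finset (TorusSite d L) := fun x =>
    Finset.univ.filter fun y => (∀ i, ((y - x) i).valMinAbs.natAbs ≤ Rv i) ∧
      ¬ ∀ i, ((y - x) i).valMinAbs.natAbs < Rv i with hSdef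
  have memA : ∀ x y, y ∈ A x ↔ ∀ i, ((y - x) i).valMinAbs.natAbs ≤ Rv i := fun x y => by simp [hAdef]
  have memS : ∀ x y, y ∈ S x ↔ (∀ i, ((y - x) i).valMinAbs.natAbs ≤ Rv i) ∧
      ¬ ∀ i, ((y - x) i).valMinAbs.natAbs < Rv i := fun x y => by simp [hSdef]
  have hxA : ∀ x, x ∈ A x := fun x => by
    rw [memA]; intro i; simp
  refine twoPoint_le_pow_of_shell_rowSum_le hJ0 A S (fun x y hy => ?_) hxA (fun x p hp => ?_)
    (s := aboxShellSum Jf Rv) (fun x => ?_) c (d := fun y => aIndex Rv (fun i => ((y - c) i).valMinAbs))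
    (fun x hx hcA => ?_) (fun x b hb => ?_) a
  · -- `S x ⊆ A x`
    rw [memA]; rw [memS] at hy; exact hy.1
  · -- every bond leaving the box starts on the shell (range one, per coordinate)
    obtain ⟨i, hi⟩ := torusXY_exists_single_of_symmCoupling_ne_zero hp
    have hL2 : 2 ≤ L := by have := hL3 i; omega
    -- symmetric statement for a bond `(y, y + eᵢ)` in either orientation
    have key : ∀ y z : TorusSite d L, (z = y + Pi.single i 1 ∨ y = z + Pi.single i 1) →
        y ∈ A x → z ∉ A x → y ∈ S x := by
      intro y z hyz hy hz
      rw [memA] at hy hz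
      rw [memS]
      refine ⟨hy, fun hlt => hz fun j => ?_⟩
      rcases hyz with rfl | rfl
      · exact (natAbs_valMinAbs_coord_add_single_le hL2 x y i j).1.trans (hlt j)
      · exact (natAbs_valMinAbs_coord_add_single_le hL2 x z i j).2.trans (hlt j)
    rcases hi with hi | hi
    · exact ⟨key p.1 p.2 (Or.inl hi.symm), key p.2 p.1 (Or.inr hi.symm)⟩
    · exact ⟨key p.1 p.2 (Or.inr hi.symm), key p.2 p.1 (Or.inl hi.symm)⟩
  · -- the shell row sum of the torus box is at most `S_{Rv}(Jf)`
    let τ : TorusSite d L → abox Rv := fun y =>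
      if h : ∀ i, ((y - x) i).valMinAbs.natAbs ≤ Rv i then
        ⟨fun i => ((y - x) i).valMinAbs, mem_abox.2 h⟩
      else aCentre Rv
    have hτ_val : ∀ y, y ∈ A x → ((τ y : abox Rv) : Site d) = fun i => ((y - x) i).valMinAbs := fun y hy => by
      rw [memA] at hy
      simp only [τ, dif_pos hy]
    have hτx : τ x = aCentre Rv := by
      apply Subtype.ext
      rw [hτ_val x (hxA x), torusBoxCoord_self]
      rfl
    have hτinj : Set.InjOn τ (A x) := by
      intro y hy z hz hyz
      have h : ((τ y : abox Rv) : Site d) = ((τ z : abox Rv) : Site d) := congrArg _ hyz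
      rw [hτ_val y hy, hτ_val z hz] at h
      exact torusBoxCoord_injective x h
    have hτS : ∀ b, b ∈ S x → τ b ∈ aShell Rv := fun b hb => by
      have hbS := (memS x b).1 hb
      have hbA : b ∈ A x := (memA x b).2 hbS.1
      simp only [aShell, Finset.mem_filter, Finset.mem_univ, true_and]
      rw [hτ_val b hbA, mem_aInterior]
      exact hbS.2
    -- domination of the inside couplings by the reference couplings
    have hdom' : ∀ y ∈ A x, ∀ z ∈ A x, insideCoupling J (A x) (S x) (y, z) ≤ aRefCoupling Jf Rv (τ y, τ z) := by
      intro y hy z hz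
      by_cases hS : y ∈ S x ∧ z ∈ S x
      · rw [insideCoupling_of_shell (A := A x) hS.1 hS.2]
        exact aRefCoupling_nonneg hJf0 Rv _
      · rw [insideCoupling_of_mem (p := (y, z)) hy hz hS]
        have hyA := (memA x y).1 hy
        have hzA := (memA x z).1 hz
        have hnotshell : ¬(((τ y : abox Rv) : Site d) ∉ aInterior Rv ∧ ((τ z : abox Rv) : Site d) ∉ aInterior Rv) := by
          rw [hτ_val y hy, hτ_val z hz, mem_aInterior, mem_aInterior]
          intro h
          exact hS ⟨(memS x y).2 ⟨hyA, h.1⟩, (memS x z).2 ⟨hzA, h.2⟩⟩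
        show J (y, z) ≤ aRefCoupling Jf Rv (τ y, τ z)
        unfold aRefCoupling
        rw [if_neg hnotshell, hτ_val y hy, hτ_val z hz]
        by_cases hJ0' : J (y, z) = 0
        · rw [hJ0']; exact hJf0 _ _
        · obtain ⟨i, hi⟩ := torusXY_exists_single_of_symmCoupling_ne_zero hJ0'
          have hval := torusXY_symmCoupling_add_single (hL3 i) K
          rcases hi with hi | hi
          · -- `z = y + eᵢ`: coordinates `coord z = coord y + eᵢ`
            have hzA' := hzA i
            rw [← hi] at hzA' ⊢
            rw [hJdef, (hval y i).1, torusBoxCoord_add_single_of_le (hL i) (hyA i) hzA']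
            exact (hdom _ i).1
          · -- `y = z + eᵢ`
            have hyA' := hyA i
            rw [← hi] at hyA' ⊢
            rw [hJdef, (hval z i).2, torusBoxCoord_add_single_of_le (hL i) (hzA i) hyA']
            exact (hdom _ i).2
    calc ∑ b ∈ S x, PlaneRotator.twoPoint (insideCoupling J (A x) (S x)) x b
        ≤ ∑ b ∈ S x, PlaneRotator.twoPoint (aRefCoupling Jf Rv) (aCentre Rv) (τ b) := by
          refine Finset.sum_le_sum fun b hb => ?_
          have hbA : b ∈ A x := (memA x b).2 ((memS x b).1 hb).1
          have h := twoPoint_le_of_injOn (insideCoupling_nonneg hJ0 (A x) (S x))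
            (insideCoupling_support J (A x) (S x)) τ hτinj (aRefCoupling_nonneg hJf0 Rv) hdom' (hxA x) hbA
          rwa [hτx] at h
      _ = ∑ b' ∈ (S x).image τ, PlaneRotator.twoPoint (aRefCoupling Jf Rv) (aCentre Rv) b' := by
          rw [Finset.sum_image]
          intro y hy z hz hyz
          exact hτinj ((memA x y).2 ((memS x y).1 hy).1) ((memA x z).2 ((memS x z).1 hz).1) hyz
      _ ≤ aboxShellSum Jf Rv := by
          refine Finset.sum_le_sum_of_subset_of_nonneg (fun b' hb' => ?_)
            fun b' _ _ => twoPoint_nonneg (aRefCoupling_nonneg hJf0 Rv) _ _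
          obtain ⟨b, hb, rfl⟩ := Finset.mem_image.1 hb'
          exact hτS b hb
  · -- `d x ≠ 0` forces `c` out of the interior of the box of `x`
    rw [memS]; rw [memA] at hcA
    refine ⟨hcA, fun hlt => hx ?_⟩
    rw [aIndex_eq_zero_iff hR, mem_aInterior]
    intro i
    rw [natAbs_valMinAbs_coord_comm]
    exact hlt i
  · -- `d` drops by at most one across a shell
    have hbA := ((memS x b).1 hb).1
    refine aIndex_le_succ_of_forall_le hR fun i => ?_
    calc ((x - c) i).valMinAbs.natAbs ≤ ((b - c) i).valMinAbs.natAbs + ((x - b) i).valMinAbs.natAbs :=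
          natAbs_valMinAbs_coord_le c b x i
      _ ≤ ((b - c) i).valMinAbs.natAbs + Rv i := by
          rw [natAbs_valMinAbs_coord_comm x b i]; exact Nat.add_le_add_left (hbA i) _

/-- The criterion with the Ginibre floor: `0 ≤ ⟨cos(θ_a − θ_c)⟩_{K,L} ≤ S_{Rv}(Jf)^{aIndex Rv (coord_c a)}`.
[cite: Lieb1980, Theorem 4 and p. 128 (boxes); Simon1980CMP, Thm 1.3] -/
theorem torusXY_expectJ_cosDiff_mem_Icc_pow_aboxShellSum {K : Fin d → ℝ} (hK : ∀ i, 0 ≤ K i) {Rv : Fin d → ℕ}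
    (hR : ∀ i, 1 ≤ Rv i) (hL : ∀ i, 2 * Rv i + 2 ≤ L) {Jf : Site d → Site d → ℝ} (hJf0 : ∀ u v, 0 ≤ Jf u v)
    (hdom : ∀ (u : Site d) (i : Fin d),
      K i / 2 ≤ Jf u (u + Pi.single i 1) ∧ K i / 2 ≤ Jf (u + Pi.single i 1) u)
    (a c : TorusSite d L) :
    (torusXY d L).expectJ (fun b => K b.2) (cosDiff a c) ∈
      Set.Icc 0 (aboxShellSum Jf Rv ^ aIndex Rv (fun i => ((a - c) i).valMinAbs)) := by
  refine ⟨?_, torusXY_expectJ_cosDiff_le_pow_aboxShellSum hK hR hL hJf0 hdom a c⟩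
  rw [(torusXY d L).expectJ_cosDiff_eq_twoPoint]
  exact twoPoint_nonneg ((torusXY d L).pairCoupling_nonneg fun b => hK b.2) a c

/-- **One direction of the exponent**: the index dominates each coordinate quotient, so if `S_{Rv}(Jf) ≤ 1` then
`⟨cos(θ_a − θ_c)⟩_{K,L} ≤ S_{Rv}(Jf)^{⌊|coord_c(a)_i| / R_i⌋}` for every direction `i` (for the slab `R_2 = 1`: decay
ACROSS the layers with exponent the cyclic layer distance). [cite: Lieb1980, Theorem 4 and p. 128 (boxes); Simon1980CMP, Thm 1.3] -/
theorem torusXY_expectJ_cosDiff_le_pow_coord {K : Fin d → ℝ} (hK : ∀ i, 0 ≤ K i) {Rv : Fin d → ℕ}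
    (hR : ∀ i, 1 ≤ Rv i) (hL : ∀ i, 2 * Rv i + 2 ≤ L) {Jf : Site d → Site d → ℝ} (hJf0 : ∀ u v, 0 ≤ Jf u v)
    (hdom : ∀ (u : Site d) (i : Fin d),
      K i / 2 ≤ Jf u (u + Pi.single i 1) ∧ K i / 2 ≤ Jf (u + Pi.single i 1) u)
    (hS1 : aboxShellSum Jf Rv ≤ 1) (a c : TorusSite d L) (i : Fin d) :
    (torusXY d L).expectJ (fun b => K b.2) (cosDiff a c) ≤
      aboxShellSum Jf Rv ^ (((a - c) i).valMinAbs.natAbs / Rv i) := by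
  refine (torusXY_expectJ_cosDiff_le_pow_aboxShellSum hK hR hL hJf0 hdom a c).trans ?_
  exact pow_le_pow_of_le_one (aboxShellSum_nonneg hJf0 Rv) hS1
    (div_le_aIndex Rv (fun j => ((a - c) j).valMinAbs) i)

end Criterion

/-! ## §4 The bridge to the angle-cube two-point function `AnisotropicRotator.corr` -/

namespace AnisotropicRotator

/- The floor files fix the Borel structure of `Circle` as a global instance (`corr`, `plateau`); the instance-generic
theorems of §1–§3 and of the free-box files are used at that instance below. -/

/-- **Bridge.** The angle-cube two-point function of the anisotropic rotator on `(ℤ/Lℤ)³` is the Gibbs expectation of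
`cos(θ_x − θ_y)` in the bond system `torusXY 3 L` with couplings `K_i` per direction:
`corr K x y = ⟨cos(θ_x − θ_y)⟩_{K,L}`. [cite: Ginibre1970, Example 4 (plane rotators)] -/
theorem corr_eq_expectJ (K : Fin 3 → ℝ) (x y : TorusSite 3 L) :
    corr K x y = (torusXY 3 L).expectJ (fun b => K b.2) (cosDiff x y) := by
  rw [corr_eq_ginibreExpect, BondSystem.expectJ]
  have h1 : (torusXY 3 L).bondChar = fun b : TorusSite 3 L × Fin 3 => diffChar b.1 (b.1 + Pi.single b.2 1) := by
    funext b; rfl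
  have h2 : (cosDiff x y : (TorusSite 3 L → Circle) → ℝ) = reChar (diffChar y x) := by
    funext θ
    rw [cosDiff_eq_reChar]
    exact reChar_diffChar_comm x y θ
  rw [h1, h2]

/-- The same in the `PlaneRotator.twoPoint` vocabulary (fibre-summed pair coupling).
[cite: Ginibre1970, Example 4 (plane rotators, general couplings J_A)] -/
theorem corr_eq_twoPoint (K : Fin 3 → ℝ) (x y : TorusSite 3 L) :
    corr K x y = PlaneRotator.twoPoint ((torusXY 3 L).pairCoupling fun b => K b.2) x y := by
  rw [corr_eq_expectJ, BondSystem.expectJ_cosDiff_eq_twoPoint]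

/-- Griffiths' first inequality: `0 ≤ corr K x y` for `K ≥ 0`. [cite: Ginibre1970, Example 4 (plane rotators)] -/
theorem corr_nonneg {K : Fin 3 → ℝ} (hK : ∀ i, 0 ≤ K i) (x y : TorusSite 3 L) : 0 ≤ corr K x y := by
  rw [corr_eq_twoPoint]
  exact twoPoint_nonneg ((torusXY 3 L).pairCoupling_nonneg fun b => hK b.2) x y

/-- `corr K x y ≤ 1`. [cite: Ginibre1970, Example 4 (plane rotators)] -/
theorem corr_le_one (K : Fin 3 → ℝ) (x y : TorusSite 3 L) : corr K x y ≤ 1 := by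
  rw [corr_eq_twoPoint]
  exact twoPoint_le_one _ x y

omit [NeZero L] in
/-- The layered coupling vector is non-negative for `K∥, K⊥ ≥ 0`. [cite: LiuStanley1972, p. 272 (layers (J, J, εJ))] -/
theorem layeredCoupling_nonneg {Kp Kz : ℝ} (hp : 0 ≤ Kp) (hz : 0 ≤ Kz) (i : Fin 3) : 0 ≤ layeredCoupling Kp Kz i := by
  unfold layeredCoupling; split_ifs <;> assumption

omit [NeZero L] in
/-- The layered coupling vector is monotone in `(K∥, K⊥)`. [cite: LiuStanley1972, p. 272 (layers (J, J, εJ))] -/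
theorem layeredCoupling_mono {Kp Kz Kp' Kz' : ℝ} (hp : Kp ≤ Kp') (hz : Kz ≤ Kz') (i : Fin 3) :
    layeredCoupling Kp Kz i ≤ layeredCoupling Kp' Kz' i := by
  unfold layeredCoupling; split_ifs <;> assumption

omit [NeZero L] in
/-- Inverse temperature scales out: `(βJ∥, βJ∥, βJ⊥) = β·(J∥, J∥, J⊥)`. [cite: LiuStanley1972, p. 272 (layers (J, J, εJ))] -/
theorem layeredCoupling_mul (β Jp Jz : ℝ) (i : Fin 3) :
    layeredCoupling (β * Jp) (β * Jz) i = β * layeredCoupling Jp Jz i := by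
  unfold layeredCoupling; split_ifs <;> rfl

omit [NeZero L] in
/-- **The two layered coupling grammars agree on bonds**: the pair coupling `LongRangeIsing.layeredCoupling J∥ J⊥` of
`ℤ³` takes the value `(J∥, J∥, J⊥)_i` on `(u, u + eᵢ)` and on `(u + eᵢ, u)`. [cite: LiuStanley1972, p. 272 (layers (J, J, εJ))] -/
theorem pairLayeredCoupling_self_add_single (Jp Jz : ℝ) (u : Site 3) (i : Fin 3) :
    LongRangeIsing.layeredCoupling Jp Jz u (u + Pi.single i 1) = layeredCoupling Jp Jz i ∧
      LongRangeIsing.layeredCoupling Jp Jz (u + Pi.single i 1) u = layeredCoupling Jp Jz i := by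
  have h1 : LongRangeIsing.layeredCoupling Jp Jz u (u + Pi.single i 1) = layeredCoupling Jp Jz i := by
    unfold LongRangeIsing.layeredCoupling layeredCoupling
    have e : u - (u + Pi.single i 1) = -(Pi.single i 1 : Site 3) := by abel
    rw [e, l1Norm_neg, l1Norm_single, if_pos rfl]
    by_cases hi : i = 2
    · subst hi; simp
    · have h0 : (-(Pi.single i (1 : ℤ) : Site 3)) 2 = 0 := by
        rw [Pi.neg_apply, Pi.single_eq_of_ne (Ne.symm hi), neg_zero]
      rw [if_pos h0, if_neg hi]
  exact ⟨h1, by rw [LongRangeIsing.layeredCoupling_symm]; exact h1⟩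

/-! ## §5 The layered XY model on the torus `(ℤ/Lℤ)³`: Lieb's slab criterion on the periodic lattice -/

/-- **Lieb's slab criterion for the PERIODIC layered XY model.** For `β, J∥, J⊥ ≥ 0`, `R ≥ 1`, `L ≥ 2R + 2` and all
sites `x, y` of `(ℤ/Lℤ)³`:

  `corr (βJ∥, βJ∥, βJ⊥) x y ≤ S^{slab}_R(β; J∥, J⊥)^{max(⌊d₀/R⌋, ⌊d₁/R⌋, d₂)}`,

`d_i = |valMinAbs (x − y)_i|` the cyclic coordinate distances and `S^{slab}_R = slabShellSum β J∥ J⊥ R` the tree's slab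
number of the FREE reference slab `[−R,R]² × {−1,0,1}` — the same number that bounds the free-boundary model on every
finite `Λ ⊂ ℤ³` (`twoPoint_layered_le_pow_slabShellSum`). [cite: Lieb1980, eq. (23), Theorem 4 and p. 128 (boxes; finite algorithm); LiuStanley1972, p. 272 (layers (J, J, εJ))] -/
theorem corr_layered_le_pow_slabShellSum {β Jp Jz : ℝ} (hβ : 0 ≤ β) (hp : 0 ≤ Jp) (hz : 0 ≤ Jz) {R : ℕ}
    (hR : 1 ≤ R) (hL : 2 * R + 2 ≤ L) (x y : TorusSite 3 L) :
    corr (layeredCoupling (β * Jp) (β * Jz)) x y ≤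
      slabShellSum β Jp Jz R ^ aIndex (slabRadii R) (fun i => ((x - y) i).valMinAbs) := by
  rw [corr_eq_expectJ]
  refine torusXY_expectJ_cosDiff_le_pow_aboxShellSum (K := layeredCoupling (β * Jp) (β * Jz))
    (fun i => layeredCoupling_nonneg (mul_nonneg hβ hp) (mul_nonneg hβ hz) i) (Rv := slabRadii R)
    (fun i => ?_) (fun i => ?_) (Jf := fun u v => β / 2 * LongRangeIsing.layeredCoupling Jp Jz u v)
    (fun u v => mul_nonneg (by positivity) (LongRangeIsing.layeredCoupling_nonneg hp hz u v)) (fun u i => ?_) x y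
  · fin_cases i <;> simp [slabRadii, hR]
  · fin_cases i <;> simp [slabRadii] <;> omega
  · obtain ⟨h1, h2⟩ := pairLayeredCoupling_self_add_single Jp Jz u i
    rw [h1, h2, layeredCoupling_mul]
    constructor <;> exact le_of_eq (by ring)

/-- **The periodic slab criterion read from two numbers of ONE two-dimensional box** (tree `slabShellSum_le_box2D`):
`corr (βJ∥, βJ∥, βJ⊥) x y ≤ (S_R(βJ∥) + βJ⊥·χ^{int}_R(βJ∥))^{max(⌊d₀/R⌋, ⌊d₁/R⌋, d₂)}`.
[cite: Lieb1980, eq. (23) and p. 128 (boxes; finite algorithm); LiuStanley1972, p. 272 (layers (J, J, εJ))] -/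
theorem corr_layered_le_pow_box2D {β Jp Jz : ℝ} (hβ : 0 ≤ β) (hp : 0 ≤ Jp) (hz : 0 ≤ Jz) {R : ℕ}
    (hR : 1 ≤ R) (hL : 2 * R + 2 ≤ L) (x y : TorusSite 3 L) :
    corr (layeredCoupling (β * Jp) (β * Jz)) x y ≤
      (nnBoxShellSum (β * Jp) 2 R + β * Jz * boxInteriorSum (β * Jp) R) ^
        aIndex (slabRadii R) (fun i => ((x - y) i).valMinAbs) := by
  refine (corr_layered_le_pow_slabShellSum hβ hp hz hR hL x y).trans ?_
  exact pow_le_pow_left₀ (aboxShellSum_nonneg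
    (fun u v => mul_nonneg (by positivity) (LongRangeIsing.layeredCoupling_nonneg hp hz _ _)) _)
    (slabShellSum_le_box2D hβ hp hz hR) _

/-- **Decay across the layers on the torus**: if `S^{slab}_R(β; J∥, J⊥) ≤ 1` then
`corr (βJ∥, βJ∥, βJ⊥) x y ≤ S^{slab}_R ^ d₂(x, y)`, `d₂` the cyclic layer distance.
[cite: Lieb1980, eq. (23) and p. 128 (boxes); LiuStanley1972, p. 272 (layers (J, J, εJ))] -/
theorem corr_layered_le_pow_layer {β Jp Jz : ℝ} (hβ : 0 ≤ β) (hp : 0 ≤ Jp) (hz : 0 ≤ Jz) {R : ℕ}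
    (hR : 1 ≤ R) (hL : 2 * R + 2 ≤ L) (hS1 : slabShellSum β Jp Jz R ≤ 1) (x y : TorusSite 3 L) :
    corr (layeredCoupling (β * Jp) (β * Jz)) x y ≤ slabShellSum β Jp Jz R ^ ((x - y) 2).valMinAbs.natAbs := by
  have hS0 : 0 ≤ slabShellSum β Jp Jz R :=
    aboxShellSum_nonneg (fun u v => mul_nonneg (by positivity) (LongRangeIsing.layeredCoupling_nonneg hp hz _ _)) _
  refine (corr_layered_le_pow_slabShellSum hβ hp hz hR hL x y).trans (pow_le_pow_of_le_one hS0 hS1 ?_)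
  have h := div_le_aIndex (slabRadii R) (fun i => ((x - y) i).valMinAbs) 2
  simpa [slabRadii] using h

/-! ## §6 No long-range order on the torus in Lieb's phase: susceptibility and plateau bounds -/

/-- **The torus sum of a box-criterion bound is dominated by the lattice sum**: for `R ≥ 1`, `0 ≤ m < 1` and every
centre `x`, `∑_y m^{aIndex (R,R,1) (coord_x y)} ≤ ∑_{z ∈ ℤ³} m^{⌊‖z‖_∞/R⌋}` (box coordinates are injective; the slab
index dominates `⌊‖·‖_∞/R⌋`; the lattice sum converges, tree `summable_pow_supNorm_div`).
[cite: Simon1980CMP, Thm 1.3 (exponential decay summed over the lattice)] -/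
theorem sum_pow_aIndex_coord_le_tsum {R : ℕ} (hR : 1 ≤ R) {m : ℝ} (hm0 : 0 ≤ m) (hm1 : m < 1) (x : TorusSite 3 L) :
    ∑ y : TorusSite 3 L, m ^ aIndex (slabRadii R) (fun i => ((y - x) i).valMinAbs) ≤
      ∑' z : Site 3, m ^ (Site.supNorm z / R) := by
  classical
  have hsum := summable_pow_supNorm_div (ν := 3) hR hm0 hm1
  set τ : TorusSite 3 L → Site 3 := fun y i => ((y - x) i).valMinAbs with hτ
  have hτinj : Function.Injective τ := torusBoxCoord_injective x
  calc ∑ y : TorusSite 3 L, m ^ aIndex (slabRadii R) (fun i => ((y - x) i).valMinAbs)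
      ≤ ∑ y : TorusSite 3 L, m ^ (Site.supNorm (τ y) / R) :=
        Finset.sum_le_sum fun y _ => pow_le_pow_of_le_one hm0 hm1.le (supNorm_div_le_aIndex_slabRadii hR (τ y))
    _ = ∑ z ∈ Finset.univ.image τ, m ^ (Site.supNorm z / R) := by
        rw [Finset.sum_image fun y _ z _ h => hτinj h]
    _ ≤ ∑' z : Site 3, m ^ (Site.supNorm z / R) :=
        hsum.sum_le_tsum _ fun z _ => pow_nonneg hm0 _

/-- **Plateau bound from a pointwise box bound.** If `corr K x y ≤ m^{aIndex (R,R,1) (coord_y x)}` for all `x, y` with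
`0 ≤ m < 1`, then `plateau_L(K) ≤ (∑_{z ∈ ℤ³} m^{⌊‖z‖_∞/R⌋}) / L³`: the torus susceptibility `∑_y corr K x y` is bounded
uniformly in `L` and the long-range-order parameter is `O(L⁻³)`.
[cite: Simon1980CMP, Thm 1.3 (exponential decay summed over the lattice); FriedliVelenikSMLS2017, (10.39)–(10.42) (the plateau)] -/
theorem plateau_le_of_corr_le_pow {K : Fin 3 → ℝ} {R : ℕ} (hR : 1 ≤ R) {m : ℝ} (hm0 : 0 ≤ m) (hm1 : m < 1)
    (h : ∀ x y : TorusSite 3 L, corr K x y ≤ m ^ aIndex (slabRadii R) (fun i => ((x - y) i).valMinAbs)) :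
    plateau L K ≤ (∑' z : Site 3, m ^ (Site.supNorm z / R)) / (L : ℝ) ^ 3 := by
  set T : ℝ := ∑' z : Site 3, m ^ (Site.supNorm z / R) with hT
  have hL0 : (0 : ℝ) < (L : ℝ) := by exact_mod_cast Nat.pos_of_ne_zero (NeZero.ne L)
  have hrow : ∀ x : TorusSite 3 L, ∑ y : TorusSite 3 L, corr K x y ≤ T := fun x => by
    refine (Finset.sum_le_sum fun y _ => h x y).trans ?_
    have e : ∀ y : TorusSite 3 L, aIndex (slabRadii R) (fun i => ((x - y) i).valMinAbs) =
        aIndex (slabRadii R) (fun i => ((y - x) i).valMinAbs) := fun y =>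
      aIndex_congr_natAbs _ fun i => natAbs_valMinAbs_coord_comm x y i
    simp only [e]
    exact sum_pow_aIndex_coord_le_tsum hR hm0 hm1 x
  have hcard : (Finset.univ : Finset (TorusSite 3 L)).card = L ^ 3 := by
    rw [Finset.card_univ, card_torusSite]
  unfold plateau
  rw [div_le_div_iff₀ (by positivity) (by positivity)]
  calc (∑ x : TorusSite 3 L, ∑ y : TorusSite 3 L, corr K x y) * (L : ℝ) ^ 3
      ≤ (∑ _x : TorusSite 3 L, T) * (L : ℝ) ^ 3 :=
        mul_le_mul_of_nonneg_right (Finset.sum_le_sum fun x _ => hrow x) (by positivity)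
    _ = T * (L : ℝ) ^ 6 := by
        rw [Finset.sum_const, hcard, nsmul_eq_mul]; push_cast; ring

/-- **No long-range order on the torus when one slab number is small**: if `S^{slab}_R(β; J∥, J⊥) ≤ m < 1` then for every
`L ≥ 2R + 2`, `plateau_L(βJ∥, βJ∥, βJ⊥) ≤ (∑_{z ∈ ℤ³} m^{⌊‖z‖_∞/R⌋}) / L³`. [cite: Lieb1980, p. 128 (φ(β) < 1 for a box ⇒ exponential decay); Simon1980CMP, Thm 1.3] -/
theorem plateau_layered_le_of_slabShellSum_le {β Jp Jz : ℝ} (hβ : 0 ≤ β) (hp : 0 ≤ Jp) (hz : 0 ≤ Jz) {R : ℕ}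
    (hR : 1 ≤ R) (hL : 2 * R + 2 ≤ L) {m : ℝ} (hSm : slabShellSum β Jp Jz R ≤ m) (hm1 : m < 1) :
    plateau L (layeredCoupling (β * Jp) (β * Jz)) ≤ (∑' z : Site 3, m ^ (Site.supNorm z / R)) / (L : ℝ) ^ 3 := by
  have hS0 : 0 ≤ slabShellSum β Jp Jz R :=
    aboxShellSum_nonneg (fun u v => mul_nonneg (by positivity) (LongRangeIsing.layeredCoupling_nonneg hp hz _ _)) _
  exact plateau_le_of_corr_le_pow hR (hS0.trans hSm) hm1 fun x y =>
    (corr_layered_le_pow_slabShellSum hβ hp hz hR hL x y).trans (pow_le_pow_left₀ hS0 hSm _)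

/-- **The plateau tends to zero**: under a uniform `O(L⁻³)` bound valid for `L ≥ L₁`, for every `ε > 0` the plateau is
`≤ ε` for all large `L`. [cite: FriedliVelenikSMLS2017, (10.39)–(10.42) (the plateau) — plumbing] -/
theorem plateau_eventually_le_of_le_div {K : Fin 3 → ℝ} {T : ℝ} {L₁ : ℕ}
    (h : ∀ (L : ℕ) [NeZero L], L₁ ≤ L → plateau L K ≤ T / (L : ℝ) ^ 3) {ε : ℝ} (hε : 0 < ε) :
    ∃ L₀ : ℕ, ∀ (L : ℕ) [NeZero L], L₀ ≤ L → plateau L K ≤ ε := by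
  obtain ⟨N, hN⟩ := exists_nat_gt (T / ε)
  refine ⟨max L₁ (max N 1), fun L _ hL => (h L (le_of_max_le_left hL)).trans ?_⟩
  have hNL : N ≤ L := le_trans (le_max_left _ _) (le_of_max_le_right hL)
  have hL1 : 1 ≤ L := le_trans (le_max_right _ _) (le_of_max_le_right hL)
  have hLr : (1 : ℝ) ≤ (L : ℝ) := by exact_mod_cast hL1
  have hLpos : (0 : ℝ) < (L : ℝ) := by linarith
  have hTL : T / ε < (L : ℝ) := hN.trans_le (by exact_mod_cast hNL)
  have hT' : T < ε * (L : ℝ) := by rwa [div_lt_iff₀ hε, mul_comm] at hTL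
  rw [div_le_iff₀ (by positivity)]
  calc T ≤ ε * (L : ℝ) := hT'.le
    _ ≤ ε * (L : ℝ) ^ 3 := by
        refine mul_le_mul_of_nonneg_left ?_ hε.le
        calc (L : ℝ) = (L : ℝ) ^ 1 := (pow_one _).symm
          _ ≤ (L : ℝ) ^ 3 := pow_le_pow_right₀ hLr (by norm_num)

/-! ### The weak-interlayer windows of Lieb's finite algorithm, on the torus -/

omit [NeZero L] in
/-- **The index of the unit cube is the sup norm**: `aIndex (1,1,1) z = ‖z‖_∞`. [cite: Simon1980CMP, Thm 1.3 — plumbing] -/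
theorem aIndex_slabRadii_one (z : Site 3) : aIndex (slabRadii 1) z = Site.supNorm z := by
  unfold aIndex Site.supNorm
  refine Finset.sup_congr rfl fun i _ => ?_
  have h1 : slabRadii 1 i = 1 := by fin_cases i <;> rfl
  rw [h1, Nat.div_one]

/-- **The explicit-window template on the torus.** If `0 < x`, `0 ≤ y`, `0 < r₁`, `r₁² ≤ x² + 4` and
`4x/r₁ + y ≤ m₀` (Lieb's star number `S_1 = 4u`, Amos' bound `u(x) ≤ x/√(x²+4)`, `χ^{int}_1 = 1`), then for all
`β, J∥, J⊥ ≥ 0` with `βJ∥ ≤ x`, `βJ⊥ ≤ y`, every `L ≥ 4` and all `a, c ∈ (ℤ/Lℤ)³`: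
`corr (βJ∥, βJ∥, βJ⊥) a c ≤ m₀^{dist_∞(a, c)}`. [cite: Lieb1980, Theorem 4 (β_c ≥ 0.52 for ν = 2); Amos1974, eq. (11) (m = 0)] -/
theorem corr_layered_le_pow_of_certificate {β Jp Jz x y r₁ m₀ : ℝ} (hβ : 0 ≤ β) (hp : 0 ≤ Jp) (hz : 0 ≤ Jz)
    (hx0 : 0 < x) (hy0 : 0 ≤ y) (hr₁ : 0 < r₁) (h₁ : r₁ ^ 2 ≤ x ^ 2 + 4) (hm : 4 * x / r₁ + y ≤ m₀)
    (hxle : β * Jp ≤ x) (hyle : β * Jz ≤ y) (hL : 4 ≤ L) (a c : TorusSite 3 L) :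
    corr (layeredCoupling (β * Jp) (β * Jz)) a c ≤ m₀ ^ torusDist a c := by
  -- Griffiths–Ginibre: pass to the couplings `(x, x, y)`
  have hmono : corr (layeredCoupling (β * Jp) (β * Jz)) a c ≤ corr (layeredCoupling x y) a c :=
    corr_mono (fun i => layeredCoupling_nonneg (mul_nonneg hβ hp) (mul_nonneg hβ hz) i)
      (fun i => layeredCoupling_mono hxle hyle i) a c
  refine hmono.trans ?_
  -- the unit slab on the torus, then the 2D reduction `S^{slab}_1 ≤ S_1(x) + y·χ^{int}_1(x) = 4u(x) + y`
  have hbox := corr_layered_le_pow_box2D (β := 1) (Jp := x) (Jz := y) zero_le_one hx0.le hy0 le_rfl hL a c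
  rw [one_mul, one_mul, nnBoxShellSum_two_one, boxInteriorSum_one, mul_one, aIndex_slabRadii_one,
    supNorm_torusBoxCoord c a] at hbox
  have hu0 : 0 ≤ besselI 1 x / besselI 0 x := div_nonneg (besselI_nonneg hx0.le 1) (besselI_nonneg hx0.le 0)
  have hbase0 : 0 ≤ 4 * (besselI 1 x / besselI 0 x) + y := by positivity
  have hbase : 4 * (besselI 1 x / besselI 0 x) + y ≤ m₀ := by
    have hs₁ : r₁ ≤ Real.sqrt (x ^ 2 + 4) := Real.le_sqrt_of_sq_le h₁
    have e₁ : x / Real.sqrt (x ^ 2 + 4) ≤ x / r₁ := div_le_div_of_nonneg_left hx0.le hr₁ hs₁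
    have hu : besselI 1 x / besselI 0 x ≤ x / r₁ := (besselRatio_le hx0).trans e₁
    have e₃ : 4 * x / r₁ = 4 * (x / r₁) := by ring
    linarith
  exact hbox.trans (pow_le_pow_left₀ hbase0 hbase _)

/-- **The `(K₀, ε₀, m₀) = (1/2, 0.0298, 0.99997)` window on the torus**: `βJ∥ ≤ 1/2 ∧ βJ⊥ ≤ 149/5000 ⇒
corr (βJ∥, βJ∥, βJ⊥) a c ≤ 0.99997^{dist_∞(a,c)}` for every `L ≥ 4` (certificate `√(17/4) ≥ 4123/2000`,
`4000/4123 + 149/5000 = 0.99996… ≤ 0.99997`). [cite: Lieb1980, Theorem 4 (β_c ≥ 0.52 for ν = 2); Amos1974, eq. (11) (m = 0)] -/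
theorem corr_layered_window_half {β Jp Jz : ℝ} (hβ : 0 ≤ β) (hp : 0 ≤ Jp) (hz : 0 ≤ Jz)
    (hx : β * Jp ≤ 1 / 2) (hy : β * Jz ≤ 149 / 5000) (hL : 4 ≤ L) (a c : TorusSite 3 L) :
    corr (layeredCoupling (β * Jp) (β * Jz)) a c ≤ (99997 / 100000 : ℝ) ^ torusDist a c :=
  corr_layered_le_pow_of_certificate (x := 1 / 2) (y := 149 / 5000) (r₁ := 4123 / 2000) hβ hp hz
    (by norm_num) (by norm_num) (by norm_num) (by norm_num) (by norm_num) hx hy hL a c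

/-- **The near-star window `(0.51, 0.0115, 0.99993)` on the torus**: `βJ∥ ≤ 51/100 ∧ βJ⊥ ≤ 23/2000 ⇒
corr (βJ∥, βJ∥, βJ⊥) a c ≤ 0.99993^{dist_∞(a,c)}` for every `L ≥ 4` (certificate `√4.2601 ≥ 2.0639`).
[cite: Lieb1980, Theorem 4 (β_c ≥ 0.52 for ν = 2); Amos1974, eq. (11) (m = 0)] -/
theorem corr_layered_window_near_star {β Jp Jz : ℝ} (hβ : 0 ≤ β) (hp : 0 ≤ Jp) (hz : 0 ≤ Jz)
    (hx : β * Jp ≤ 51 / 100) (hy : β * Jz ≤ 23 / 2000) (hL : 4 ≤ L) (a c : TorusSite 3 L) :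
    corr (layeredCoupling (β * Jp) (β * Jz)) a c ≤ (99993 / 100000 : ℝ) ^ torusDist a c :=
  corr_layered_le_pow_of_certificate (x := 51 / 100) (y := 23 / 2000) (r₁ := 20639 / 10000) hβ hp hz
    (by norm_num) (by norm_num) (by norm_num) (by norm_num) (by norm_num) hx hy hL a c

/-- A torus-distance bound is a unit-cube box bound: `m^{dist_∞(a,c)} = m^{aIndex (1,1,1) (coord_c a)}`.
[cite: Simon1980CMP, Thm 1.3 — plumbing] -/
theorem pow_torusDist_eq_pow_aIndex_one (m : ℝ) (a c : TorusSite 3 L) :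
    m ^ torusDist a c = m ^ aIndex (slabRadii 1) (fun i => ((a - c) i).valMinAbs) := by
  rw [aIndex_slabRadii_one, supNorm_torusBoxCoord c a]

/-- **No long-range order on the torus in the headline window**: for `T ≥ 2J∥ > 0` and `0 ≤ J⊥ ≤ 0.0298·T`
(in particular for every `J⊥ ≤ 0.0596·J∥`; `βJ∥ ≤ 1/2`, `βJ⊥ ≤ 0.0298` at `β = 1/T`), for every `L ≥ 4`,
`plateau_L(J∥/T, J∥/T, J⊥/T) ≤ (∑_{z ∈ ℤ³} 0.99997^{‖z‖_∞}) / L³` — versus the tree's FLOOR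
`plateau_L ≥ 1 − (1 + ln(J∥/J⊥)/(2π))·T/J∥ − ε` (`layered_longRangeOrder_log`) at low temperature: floor and ceiling on
the same order parameter. [cite: Lieb1980, Theorem 4 and p. 128 (boxes); Simon1980CMP, Thm 1.3; LiuStanley1972, p. 272 (layers (J, J, εJ))] -/
theorem plateau_le_of_two_le {Jp Jz T : ℝ} (hp : 0 < Jp) (hT : 2 * Jp ≤ T) (hz : 0 ≤ Jz)
    (hJz : Jz ≤ 149 / 5000 * T) (hL : 4 ≤ L) :
    plateau L (layeredCoupling (T⁻¹ * Jp) (T⁻¹ * Jz)) ≤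
      (∑' z : Site 3, (99997 / 100000 : ℝ) ^ Site.supNorm z) / (L : ℝ) ^ 3 := by
  have hT0 : 0 < T := by linarith
  have hβ : 0 ≤ T⁻¹ := inv_nonneg.2 hT0.le
  have hx : T⁻¹ * Jp ≤ 1 / 2 := by
    rw [inv_mul_le_iff₀ hT0]; linarith
  have hy : T⁻¹ * Jz ≤ 149 / 5000 := by
    rw [inv_mul_le_iff₀ hT0]; linarith
  have hpt : ∀ a c : TorusSite 3 L, corr (layeredCoupling (T⁻¹ * Jp) (T⁻¹ * Jz)) a c ≤
      (99997 / 100000 : ℝ) ^ aIndex (slabRadii 1) (fun i => ((a - c) i).valMinAbs) := fun a c => by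
    rw [← pow_torusDist_eq_pow_aIndex_one]
    exact corr_layered_window_half hβ hp.le hz hx hy hL a c
  have h := plateau_le_of_corr_le_pow le_rfl (by norm_num) (by norm_num) hpt
  simpa only [Nat.div_one] using h

/-! ### The qualitative weak-interlayer statement: one terminating 2D box kills torus long-range order -/

/-- **One terminating two-dimensional box gives a torus ceiling at weak interlayer coupling.** If `S_R(K₀) < 1` for
one `R ≥ 1`, put `δ = (1 − S_R(K₀))/(2(χ^{int}_R(K₀) + 1)) > 0` and `s = (1 + S_R(K₀))/2 < 1`. Then for all
`β, J∥, J⊥ ≥ 0` with `βJ∥ ≤ K₀`, `βJ⊥ ≤ δ`, every `L ≥ 2R + 2` and all `x, y`: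
`corr (βJ∥, βJ∥, βJ⊥) x y ≤ s^{max(⌊d₀/R⌋, ⌊d₁/R⌋, d₂)}`. [cite: Lieb1980, eq. (23) and p. 128 (boxes; finite algorithm); Simon1980CMP, Thm 1.3; LiuStanley1972, p. 272 (layers (J, J, εJ))] -/
theorem exists_torus_slabBound_of_nnBoxShellSum_lt_one {K₀ : ℝ} (hK0 : 0 ≤ K₀) {R : ℕ} (hR : 1 ≤ R)
    (hS : nnBoxShellSum K₀ 2 R < 1) :
    ∃ δ s : ℝ, 0 < δ ∧ 0 ≤ s ∧ s < 1 ∧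
      ∀ β Jp Jz : ℝ, 0 ≤ β → 0 ≤ Jp → 0 ≤ Jz → β * Jp ≤ K₀ → β * Jz ≤ δ →
        ∀ (L : ℕ) [NeZero L], 2 * R + 2 ≤ L → ∀ x y : TorusSite 3 L,
          corr (layeredCoupling (β * Jp) (β * Jz)) x y ≤ s ^ aIndex (slabRadii R) (fun i => ((x - y) i).valMinAbs) := by
  set S : ℝ := nnBoxShellSum K₀ 2 R with hSdef
  set χ : ℝ := boxInteriorSum K₀ R with hχdef
  have hS0 : 0 ≤ S := boxShellSum_nonneg (fun x y => mul_nonneg (by positivity) (nnCoupling_nonneg _ _)) R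
  have hχ0 : 0 ≤ χ := boxInteriorSum_nonneg hK0 R
  refine ⟨(1 - S) / (2 * (χ + 1)), (1 + S) / 2, div_pos (by linarith) (by positivity), by linarith, by linarith, ?_⟩
  intro β Jp Jz hβ hp hz hKp hKz L _ hL x y
  -- Griffiths–Ginibre: pass to the couplings `(K₀, K₀, βJ⊥)`
  have hmono : corr (layeredCoupling (β * Jp) (β * Jz)) x y ≤ corr (layeredCoupling K₀ (β * Jz)) x y :=
    corr_mono (fun i => layeredCoupling_nonneg (mul_nonneg hβ hp) (mul_nonneg hβ hz) i)
      (fun i => layeredCoupling_mono hKp le_rfl i) x y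
  refine hmono.trans ?_
  have hbox := corr_layered_le_pow_box2D (β := 1) (Jp := K₀) (Jz := β * Jz) zero_le_one hK0 (mul_nonneg hβ hz)
    hR hL x y
  simp only [one_mul] at hbox
  refine hbox.trans (pow_le_pow_left₀ (add_nonneg hS0 (mul_nonneg (mul_nonneg hβ hz) hχ0)) ?_ _)
  -- the base: `S + βJ⊥·χ ≤ S + δχ ≤ (1 + S)/2`
  have h1 : β * Jz * χ ≤ (1 - S) / (2 * (χ + 1)) * χ := mul_le_mul_of_nonneg_right hKz hχ0
  have h2 : (1 - S) / (2 * (χ + 1)) * χ ≤ (1 - S) / 2 := by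
    rw [div_mul_eq_mul_div, div_le_div_iff₀ (by positivity) (by positivity)]
    nlinarith
  linarith

/-- **The plateau form**: under the same hypotheses, `plateau_L(βJ∥, βJ∥, βJ⊥) ≤ C/L³` for `L ≥ 2R + 2` with
`C = ∑_{z ∈ ℤ³} s^{⌊‖z‖_∞/R⌋}`, hence `≤ ε` for all large `L`: NO long-range order on the torus for `βJ∥ ≤ K₀` and
`βJ⊥ ≤ δ(K₀)` as soon as Lieb's algorithm terminates at `K₀` in the plane.
[cite: Lieb1980, p. 128 (φ(β) < 1 for a box ⇒ exponential decay; finite algorithm); Simon1980CMP, Thm 1.3] -/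
theorem exists_plateau_ceiling_of_nnBoxShellSum_lt_one {K₀ : ℝ} (hK0 : 0 ≤ K₀) {R : ℕ} (hR : 1 ≤ R)
    (hS : nnBoxShellSum K₀ 2 R < 1) :
    ∃ δ C : ℝ, 0 < δ ∧ 0 ≤ C ∧
      ∀ β Jp Jz : ℝ, 0 ≤ β → 0 ≤ Jp → 0 ≤ Jz → β * Jp ≤ K₀ → β * Jz ≤ δ →
        ∀ (L : ℕ) [NeZero L], 2 * R + 2 ≤ L → plateau L (layeredCoupling (β * Jp) (β * Jz)) ≤ C / (L : ℝ) ^ 3 := by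
  obtain ⟨δ, s, hδ, hs0, hs1, h⟩ := exists_torus_slabBound_of_nnBoxShellSum_lt_one hK0 hR hS
  refine ⟨δ, ∑' z : Site 3, s ^ (Site.supNorm z / R), hδ, tsum_nonneg fun z => pow_nonneg hs0 _, ?_⟩
  intro β Jp Jz hβ hp hz hKp hKz L _ hL
  exact plateau_le_of_corr_le_pow hR hs0 hs1 fun x y => h β Jp Jz hβ hp hz hKp hKz L hL x y

/-- **The Onsager window kills torus long-range order at weak interlayer coupling.** For every `0 ≤ K₀ < log(1+√2)
= 2β_c^{Ising}(ℤ²)` there is `δ > 0` such that for all `β, J∥, J⊥ ≥ 0` with `βJ∥ ≤ K₀` and `βJ⊥ ≤ δ` and every `ε > 0`,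
`plateau_L(βJ∥, βJ∥, βJ⊥) ≤ ε` for all large `L` (Aizenman–Simon + Onsager terminate Lieb's algorithm in the plane,
tree `exists_nnBoxShellSum_lt_one_of_lt_log_one_add_sqrt_two`; then the torus slab criterion). In temperature units:
`limsup_{J⊥ → 0}` of any long-range-order temperature of the periodic layered XY model is `≤ J∥/log(1+√2) =
1.1346·J∥`, against the floor `J∥/(1 + ln(J∥/J⊥)/(2π)) → 0`.
[cite: AizenmanSimon1980RotorIsing, eq. (2); Lieb1980, eq. (23) and p. 128 (boxes; finite algorithm); LiuStanley1972, p. 272 (layers (J, J, εJ))] -/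
theorem plateau_eventually_le_of_lt_log_one_add_sqrt_two {K₀ : ℝ} (hK0 : 0 ≤ K₀)
    (hK : K₀ < Real.log (1 + Real.sqrt 2)) :
    ∃ δ : ℝ, 0 < δ ∧ ∀ β Jp Jz : ℝ, 0 ≤ β → 0 ≤ Jp → 0 ≤ Jz → β * Jp ≤ K₀ → β * Jz ≤ δ →
      ∀ ε : ℝ, 0 < ε → ∃ L₀ : ℕ, ∀ (L : ℕ) [NeZero L], L₀ ≤ L → plateau L (layeredCoupling (β * Jp) (β * Jz)) ≤ ε := by
  obtain ⟨R, hR, hS⟩ := exists_nnBoxShellSum_lt_one_of_lt_log_one_add_sqrt_two hK0 hK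
  obtain ⟨δ, C, hδ, -, h⟩ := exists_plateau_ceiling_of_nnBoxShellSum_lt_one hK0 hR hS
  refine ⟨δ, hδ, fun β Jp Jz hβ hp hz hKp hKz ε hε => ?_⟩
  exact plateau_eventually_le_of_le_div (L₁ := 2 * R + 2)
    (fun L _ hL => h β Jp Jz hβ hp hz hKp hKz L hL) hε

/-! ### The isotropic model on `(ℤ/Lℤ)³`: a ceiling next to the Fröhlich–Simon–Spencer floor -/

omit [NeZero L] in
/-- The constant coupling vector is the layered one with equal entries: `(K, K, K) = layeredCoupling K K`.
[cite: FriedliVelenikSMLS2017, §10.5.1 Example 10.22 (isotropic case)] -/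
theorem layeredCoupling_self (K : ℝ) : layeredCoupling K K = fun _ : Fin 3 => K := by
  funext i; unfold layeredCoupling; split_ifs <;> rfl

/-- **The isotropic window `(1/3, 0.991)` on the torus**: for the ISOTROPIC classical XY model on `(ℤ/Lℤ)³`,
`βJ ≤ 1/3 ⇒ corr (βJ, βJ, βJ) a c ≤ 0.991^{dist_∞(a,c)}` for every `L ≥ 4` (unit-cube slab: `4u(1/3) + 1/3 ≤
4/(3·2.0275) + 1/3 < 0.991`, certificate `√(37/9) ≥ 2.0275`; compare Lieb's `β_c ≥ 0.34` for `ν = 3`).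
[cite: Lieb1980, Theorem 4 (β_c ≥ 0.34 for ν = 3); Amos1974, eq. (11) (m = 0)] -/
theorem corr_isotropic_window_third {β J : ℝ} (hβ : 0 ≤ β) (hJ : 0 ≤ J) (hx : β * J ≤ 1 / 3) (hL : 4 ≤ L)
    (a c : TorusSite 3 L) :
    corr (fun _ : Fin 3 => β * J) a c ≤ (991 / 1000 : ℝ) ^ torusDist a c := by
  rw [← layeredCoupling_self]
  exact corr_layered_le_pow_of_certificate (x := 1 / 3) (y := 1 / 3) (r₁ := 20275 / 10000) hβ hJ hJ
    (by norm_num) (by norm_num) (by norm_num) (by norm_num) (by norm_num) hx hx hL a c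

/-- **The isotropic classical XY model on `(ℤ/Lℤ)³` is DISORDERED for `T ≥ 3J`**: for `J > 0`, `T ≥ 3J` and every
`L ≥ 4`, `plateau_L(J/T, J/T, J/T) ≤ (∑_{z ∈ ℤ³} 0.991^{‖z‖_∞}) / L³ → 0` — the kernel CEILING companion, on the same
torus plateau, of the Fröhlich–Simon–Spencer FLOOR (`isotropic_plateau_ge`: ordered for `T < J/J₀`, `J₀ = latticeGreen 0`)
and of the tree's «ordered at `T = (π/2)·J`» (`PlaneRotatorThreeDimOrderingFloor.lean`); the transition of the
three-dimensional rotator sits in the kernel bracket `[π/2, 3]·J`.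
[cite: Lieb1980, Theorem 4 (β_c ≥ 0.34 for ν = 3) and p. 128 (boxes); FriedliVelenikSMLS2017, Thm. 10.25 (the floor); Simon1980CMP, Thm 1.3] -/
theorem plateau_isotropic_le_of_three_le {J T : ℝ} (hJ : 0 < J) (hT : 3 * J ≤ T) (hL : 4 ≤ L) :
    plateau L (fun _ : Fin 3 => T⁻¹ * J) ≤ (∑' z : Site 3, (991 / 1000 : ℝ) ^ Site.supNorm z) / (L : ℝ) ^ 3 := by
  have hT0 : 0 < T := by linarith
  have hβ : 0 ≤ T⁻¹ := inv_nonneg.2 hT0.le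
  have hx : T⁻¹ * J ≤ 1 / 3 := by
    rw [inv_mul_le_iff₀ hT0]; linarith
  have hpt : ∀ a c : TorusSite 3 L, corr (fun _ : Fin 3 => T⁻¹ * J) a c ≤
      (991 / 1000 : ℝ) ^ aIndex (slabRadii 1) (fun i => ((a - c) i).valMinAbs) := fun a c => by
    rw [← pow_torusDist_eq_pow_aIndex_one]
    exact corr_isotropic_window_third hβ hJ.le hx hL a c
  have h := plateau_le_of_corr_le_pow le_rfl (by norm_num) (by norm_num) hpt
  simpa only [Nat.div_one] using h

end AnisotropicRotator

end Literature.Probability.LatticeModels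

end
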